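import Summits.KontsevichZagierPeriods.Statement
import Summits.KontsevichZagierPeriods.KontsevichZagierPeriods.Theses.ExpConservative
import Summits.KontsevichZagierPeriods.KontsevichZagierPeriods.Theses.AyoubSpecialisation

/-!
# KontsevichZagierPeriods / kernel form — the kernel form implies the statement (item form)

Problem `KontsevichZagierPeriods`, topic `KernelForm`; settles the shared "last step" item
stmt-KontsevichZagierPeriods-0197 (`kernel_implies_statement`) in the form in which it is filed:
the kernel form of Conjecture 1, spelled by its definiens

  `∀ c : KZ.FormalRep, KZ.eval c = 0 → c ∈ KZ.relations`

(every formal `ℤ`-combination of integral representations with value `0` is a consequence of the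
moves), implies the KZ-literal period conjecture `KontsevichZagierPeriods`
(`= Literature.Periods.KZPeriodConjecture`: two representations of the shape of KZ's Definition
with the same value are `KZ.Equivalent`). Proof: `r.value = r'.value` gives
`KZ.eval ([r] - [r']) = r.value - r'.value = 0` (`map_sub`, `KZ.eval_of`), and
`KZ.Equivalent r r'` is by definition `[r] - [r'] ∈ KZ.relations`; the rationality hypotheses on
the two endpoints are not used.

The companion file `Theorems/KernelFormKernelImpliesStatement.lean` proves the same implication
with the antecedent written as the constant `Literature.NumberTheory.Transcendental.KZKernelConjecture`
(definitionally, but not reducibly, equal to the spelled-out form above); this file states it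
against the item's literal signature and against the route declarations
`Theses.ExpConservative.KernelImpliesStatement` and `Theses.AyoubSpecialisation.KernelImpliesStatement`
(both routes want the item at rank 1), so that the gate's exact-match probes close it.

Sources: M. Kontsevich, D. Zagier, *Periods* (2001), §1.2 (Conjecture 1); A. Huber,
S. Müller-Stach, *Periods and Nori Motives* (2017), §13.2 (kernel / injectivity reformulation).
Deliberately NOT here: any claim about the kernel form itself (an open conjecture; the results of
this file are implications only).
-/

namespace Summit.KontsevichZagierPeriods.KernelForm

/-- Settles stmt-KontsevichZagierPeriods-0197 (`kernel_implies_statement`), literal item form: if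
every formal combination `c` of integral representations with `KZ.eval c = 0` lies in
`KZ.relations` (kernel form of Kontsevich–Zagier's Conjecture 1), then `KontsevichZagierPeriods`
holds, i.e. any two rational-shape representations `r`, `r'` with `r.value = r'.value` are
`KZ.Equivalent`: apply the hypothesis to `c = [r] - [r']`, whose evaluation is
`r.value - r'.value = 0`. [Kontsevich–Zagier 2001, §1.2] [folklore] -/
theorem kernel_implies_statement :
    (∀ c : Literature.NumberTheory.Transcendental.KZ.FormalRep,
        Literature.NumberTheory.Transcendental.KZ.eval c = 0 →
          c ∈ Literature.NumberTheory.Transcendental.KZ.relations) →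
      KontsevichZagierPeriods := by
  intro hK n m r r' _ _ hv
  apply hK
  simp [Literature.NumberTheory.Transcendental.KZ.eval_of, hv]

/-- Route ExpConservative, item stmt-KontsevichZagierPeriods-0197: the route declaration
`KernelImpliesStatement` (kernel form, spelled by its definiens, implies `KontsevichZagierPeriods`)
holds — it is `kernel_implies_statement` read through the route's definition. [folklore] -/
theorem expConservative_kernelImpliesStatement :
    Summit.KontsevichZagierPeriods.KontsevichZagierPeriods.Theses.ExpConservative.KernelImpliesStatement := by
  unfold Summit.KontsevichZagierPeriods.KontsevichZagierPeriods.Theses.ExpConservative.KernelImpliesStatement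
  exact kernel_implies_statement

/-- Route AyoubSpecialisation, item stmt-KontsevichZagierPeriods-0197: the route declaration
`KernelImpliesStatement` (kernel form, spelled by its definiens, implies `KontsevichZagierPeriods`)
holds — it is `kernel_implies_statement` read through the route's definition. [folklore] -/
theorem ayoubSpecialisation_kernelImpliesStatement :
    Summit.KontsevichZagierPeriods.KontsevichZagierPeriods.Theses.AyoubSpecialisation.KernelImpliesStatement := by
  unfold Summit.KontsevichZagierPeriods.KontsevichZagierPeriods.Theses.AyoubSpecialisation.KernelImpliesStatement
  exact kernel_implies_statement

end Summit.KontsevichZagierPeriods.KernelForm
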